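import Summits.CriticalPhenomena.PercolationContinuityZ3.Theorems.PercNearOneGluingAdditiveGluingKnThm2GoodAux
import HarnessLib

/-! # Crux `PercNearOneGluing.AdditiveGluing` (stmt-CriticalPhenomena-4576): a menu of set-BHK instances

Support file (`--supports stmt-CriticalPhenomena-4576`, deep seat r2).  Tools only, no definitions, no named facts.
The landed wrappers `knThm2_bhkOne/Two` instantiate the two van den Berg–Häggström–Kahn inequalities (hypotheses `hB1`,
`hB2` = the two halves of the landed `stub_bhkSets`) with the two particular increasing functions `1{S ↔ o}` and
`1{∀ s ∈ S, s ↔ b}`.  Certificate-style proofs of the three-relay inequalities (T1)/(Ψ)/(K3a) need MANY instances, with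
increasing functions that are products of such literals (e.g. `1{o ∈ C(S)}·1{b ∈ C(S)}`, `1{a₁ ↔ a₂} = 1{∀ s ∈ {a₁,a₂}, s ↔ a₂}`).
This file provides the generic instances:
* `bhkMenu_one` / `bhkMenu_two`: BHK Thm 1.3 / 1.4 for indicator functions of ARBITRARY up-sets `𝓕, 𝓖` of edge sets,
  stated directly as inequalities between products of probabilities of the events `E, E'` they cut out
  (`C_S(ω) ∈ 𝓕 ↔ ω ∈ E`);
* the literals `{C | ∃ s ∈ S, s ↔ x in C}` (`bhkMenu_any_*`) and `{C | ∀ s ∈ S, s ↔ x in C}` (`bhkMenu_all_*`): they are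
  up-sets and at `C = C_S(ω)` cut out `⋃_{s∈S} {s ↔ x}` resp. `⋂_{s∈S} {s ↔ x}`; up-sets are closed under `∩`
  (`IsUpperSet.inter`), and membership in an intersection is memberwise — so any finite conjunction of literals is
  available by `refine bhkMenu_one hB1 w S X (𝓕 ∩ 𝓕') … (h𝓕.inter h𝓕') …`.
[cite: VandenbergHaggstromKahn2005, Thm. 1.3 (p. 6), Thm. 1.4 (p. 7)]
-/

namespace Summit.CriticalPhenomena.PercolationContinuityZ3.Theorems

open MeasureTheory Set
open Literature.Probability.LatticeModels (prodBernoulli)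
open Literature.Probability.Percolation (BondConfig openConn openGraph openEdgeCluster openGraph_mono)

noncomputable section
open Classical

section General
variable {V : Type*}

/-- The indicator of an up-set of edge sets is an increasing function. [folklore] -/
theorem bhkMenu_monotone_indicator {𝓕 : Set (Set (Sym2 V))} (h𝓕 : IsUpperSet 𝓕) :
    Monotone (𝓕.indicator (1 : Set (Sym2 V) → ℝ)) := by
  intro C C' hCC'
  by_cases h : C ∈ 𝓕
  · rw [Set.indicator_of_mem h, Set.indicator_of_mem (h𝓕 hCC' h), Pi.one_apply, Pi.one_apply]
  · rw [Set.indicator_of_notMem h]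
    exact Set.indicator_nonneg (fun _ _ => zero_le_one) _

/-- The literal `{C | ∃ s ∈ S, s ↔ x in C}` is an up-set. [folklore] -/
theorem bhkMenu_any_isUpperSet (S : Finset V) (x : V) :
    IsUpperSet {C : Set (Sym2 V) | ∃ s ∈ S, (openGraph C).Reachable s x} := by
  intro C C' hCC' h
  obtain ⟨s, hs, hr⟩ := h
  exact ⟨s, hs, hr.mono (openGraph_mono hCC')⟩

/-- The literal `{C | ∀ s ∈ S, s ↔ x in C}` is an up-set. [folklore] -/
theorem bhkMenu_all_isUpperSet (S : Finset V) (x : V) :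
    IsUpperSet {C : Set (Sym2 V) | ∀ s ∈ S, (openGraph C).Reachable s x} :=
  fun _ _ hCC' h s hs => (h s hs).mono (openGraph_mono hCC')

/-- At `C = C_S(ω)` the literal `{∃ s ∈ S, s ↔ x}` cuts out `⋃_{s ∈ S} {s ↔ x}`. [folklore] -/
theorem bhkMenu_any_mem (S : Finset V) (x : V) (ω : BondConfig V) :
    (⋃ s' ∈ S, openEdgeCluster ω s') ∈ {C : Set (Sym2 V) | ∃ s ∈ S, (openGraph C).Reachable s x} ↔
      ω ∈ ⋃ s ∈ S, (openConn s x : Set (BondConfig V)) := by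
  simp only [Set.mem_setOf_eq, Set.mem_iUnion, exists_prop]
  constructor
  · rintro ⟨s, hs, hr⟩
    exact ⟨s, hs, (knThm2_reachable_biUnion_iff S hs x ω).1 hr⟩
  · rintro ⟨s, hs, hr⟩
    exact ⟨s, hs, (knThm2_reachable_biUnion_iff S hs x ω).2 hr⟩

/-- At `C = C_S(ω)` the literal `{∀ s ∈ S, s ↔ x}` cuts out `⋂_{s ∈ S} {s ↔ x}`. [folklore] -/
theorem bhkMenu_all_mem (S : Finset V) (x : V) (ω : BondConfig V) :
    (⋃ s' ∈ S, openEdgeCluster ω s') ∈ {C : Set (Sym2 V) | ∀ s ∈ S, (openGraph C).Reachable s x} ↔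
      ω ∈ ⋂ s ∈ S, (openConn s x : Set (BondConfig V)) := by
  simp only [Set.mem_setOf_eq, Set.mem_iInter]
  constructor
  · intro h s hs
    exact (knThm2_reachable_biUnion_iff S hs x ω).1 (h s hs)
  · intro h s hs
    exact (knThm2_reachable_biUnion_iff S hs x ω).2 (h s hs)

/-- The indicator of an up-set `𝓕` at `C_S(ω)` is the indicator of the event it cuts out. [folklore] -/
theorem bhkMenu_indicator_eq {S : Finset V} {𝓕 : Set (Set (Sym2 V))} {E : Set (BondConfig V)}
    (hE : ∀ ω : BondConfig V, (⋃ s ∈ S, openEdgeCluster ω s) ∈ 𝓕 ↔ ω ∈ E) (ω : BondConfig V) :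
    𝓕.indicator (1 : Set (Sym2 V) → ℝ) (⋃ s ∈ S, openEdgeCluster ω s) = E.indicator 1 ω := by
  by_cases h : ω ∈ E
  · rw [Set.indicator_of_mem ((hE ω).2 h), Set.indicator_of_mem h, Pi.one_apply, Pi.one_apply]
  · rw [Set.indicator_of_notMem (fun h' => h ((hE ω).1 h')), Set.indicator_of_notMem h]

end General

variable {n : ℕ}

/-- **BHK Thm 1.3 (one cluster given `S ↮ X`) for the indicators of two arbitrary up-sets `𝓕, 𝓖`** cutting out the
events `E, E'`: `μ(N ∩ E)·μ(N ∩ E') ≤ μ(N)·μ(N ∩ (E ∩ E'))`, `N = {S ↮ X}` (hypothesis `hB1` = first half of the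
landed `stub_bhkSets`). [cite: VandenbergHaggstromKahn2005, Thm. 1.3 (p. 6)] -/
theorem bhkMenu_one
    (hB1 : ∀ (n : ℕ) (w : Sym2 (Fin n) → unitInterval) (S : Finset (Fin n)) (X : Set (Fin n))
        (F G : Set (Sym2 (Fin n)) → ℝ), Monotone F → Monotone G → (∀ s ∈ S, s ∉ X) →
        (∫ ω in {ω : BondConfig (Fin n) | ∀ s ∈ S, ∀ x ∈ X, ¬ (openGraph ω).Reachable s x},
            F (⋃ s ∈ S, openEdgeCluster ω s) ∂(prodBernoulli w)) *
          (∫ ω in {ω : BondConfig (Fin n) | ∀ s ∈ S, ∀ x ∈ X, ¬ (openGraph ω).Reachable s x},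
            G (⋃ s ∈ S, openEdgeCluster ω s) ∂(prodBernoulli w)) ≤
        (prodBernoulli w).real
            {ω : BondConfig (Fin n) | ∀ s ∈ S, ∀ x ∈ X, ¬ (openGraph ω).Reachable s x} *
          ∫ ω in {ω : BondConfig (Fin n) | ∀ s ∈ S, ∀ x ∈ X, ¬ (openGraph ω).Reachable s x},
            F (⋃ s ∈ S, openEdgeCluster ω s) * G (⋃ s ∈ S, openEdgeCluster ω s)
              ∂(prodBernoulli w))
    (w : Sym2 (Fin n) → unitInterval) (S : Finset (Fin n)) (X : Set (Fin n))
    (𝓕 𝓖 : Set (Set (Sym2 (Fin n)))) (h𝓕 : IsUpperSet 𝓕) (h𝓖 : IsUpperSet 𝓖)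
    (E E' : Set (BondConfig (Fin n)))
    (hE : ∀ ω : BondConfig (Fin n), (⋃ s ∈ S, openEdgeCluster ω s) ∈ 𝓕 ↔ ω ∈ E)
    (hE' : ∀ ω : BondConfig (Fin n), (⋃ s ∈ S, openEdgeCluster ω s) ∈ 𝓖 ↔ ω ∈ E')
    (hSX : ∀ s ∈ S, s ∉ X) :
    (prodBernoulli w).real
          ({ω : BondConfig (Fin n) | ∀ s ∈ S, ∀ x ∈ X, ¬ (openGraph ω).Reachable s x} ∩ E) *
        (prodBernoulli w).real
          ({ω : BondConfig (Fin n) | ∀ s ∈ S, ∀ x ∈ X, ¬ (openGraph ω).Reachable s x} ∩ E') ≤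
      (prodBernoulli w).real
          {ω : BondConfig (Fin n) | ∀ s ∈ S, ∀ x ∈ X, ¬ (openGraph ω).Reachable s x} *
        (prodBernoulli w).real
          ({ω : BondConfig (Fin n) | ∀ s ∈ S, ∀ x ∈ X, ¬ (openGraph ω).Reachable s x} ∩ (E ∩ E')) := by
  have key := hB1 n w S X (𝓕.indicator 1) (𝓖.indicator 1)
    (bhkMenu_monotone_indicator h𝓕) (bhkMenu_monotone_indicator h𝓖) hSX
  simp only [bhkMenu_indicator_eq hE, bhkMenu_indicator_eq hE'] at key
  have h := knThm2_setIntegral_indicator w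
    {ω : BondConfig (Fin n) | ∀ s ∈ S, ∀ x ∈ X, ¬ (openGraph ω).Reachable s x} E E'
  have h' := knThm2_setIntegral_indicator w
    {ω : BondConfig (Fin n) | ∀ s ∈ S, ∀ x ∈ X, ¬ (openGraph ω).Reachable s x} E' E'
  rw [h.1, h'.1, h.2] at key
  exact key

/-- **BHK Thm 1.4 (the clusters of disjoint `S, S'` given `S ↮ S'`) for the indicators of two arbitrary up-sets**
`𝓕` (evaluated at `C_S`) and `𝓖` (at `C_{S'}`), cutting out `E, E'`:
`μ(N)·μ(N ∩ (E ∩ E')) ≤ μ(N ∩ E)·μ(N ∩ E')`, `N = {S ↮ S'}` (hypothesis `hB2` = second half of `stub_bhkSets`).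
[cite: VandenbergHaggstromKahn2005, Thm. 1.4 (p. 7)] -/
theorem bhkMenu_two
    (hB2 : ∀ (n : ℕ) (w : Sym2 (Fin n) → unitInterval) (S S' : Finset (Fin n))
        (F G : Set (Sym2 (Fin n)) → ℝ), Monotone F → Monotone G → Disjoint S S' →
        (prodBernoulli w).real
            {ω : BondConfig (Fin n) | ∀ s ∈ S, ∀ x ∈ S', ¬ (openGraph ω).Reachable s x} *
          (∫ ω in {ω : BondConfig (Fin n) | ∀ s ∈ S, ∀ x ∈ S', ¬ (openGraph ω).Reachable s x},
            F (⋃ s ∈ S, openEdgeCluster ω s) * G (⋃ s ∈ S', openEdgeCluster ω s)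
              ∂(prodBernoulli w)) ≤
        (∫ ω in {ω : BondConfig (Fin n) | ∀ s ∈ S, ∀ x ∈ S', ¬ (openGraph ω).Reachable s x},
            F (⋃ s ∈ S, openEdgeCluster ω s) ∂(prodBernoulli w)) *
          (∫ ω in {ω : BondConfig (Fin n) | ∀ s ∈ S, ∀ x ∈ S', ¬ (openGraph ω).Reachable s x},
            G (⋃ s ∈ S', openEdgeCluster ω s) ∂(prodBernoulli w)))
    (w : Sym2 (Fin n) → unitInterval) (S S' : Finset (Fin n))
    (𝓕 𝓖 : Set (Set (Sym2 (Fin n)))) (h𝓕 : IsUpperSet 𝓕) (h𝓖 : IsUpperSet 𝓖)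
    (E E' : Set (BondConfig (Fin n)))
    (hE : ∀ ω : BondConfig (Fin n), (⋃ s ∈ S, openEdgeCluster ω s) ∈ 𝓕 ↔ ω ∈ E)
    (hE' : ∀ ω : BondConfig (Fin n), (⋃ s ∈ S', openEdgeCluster ω s) ∈ 𝓖 ↔ ω ∈ E')
    (hSS' : Disjoint S S') :
    (prodBernoulli w).real
          {ω : BondConfig (Fin n) | ∀ s ∈ S, ∀ x ∈ S', ¬ (openGraph ω).Reachable s x} *
        (prodBernoulli w).real
          ({ω : BondConfig (Fin n) | ∀ s ∈ S, ∀ x ∈ S', ¬ (openGraph ω).Reachable s x} ∩ (E ∩ E')) ≤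
      (prodBernoulli w).real
          ({ω : BondConfig (Fin n) | ∀ s ∈ S, ∀ x ∈ S', ¬ (openGraph ω).Reachable s x} ∩ E) *
        (prodBernoulli w).real
          ({ω : BondConfig (Fin n) | ∀ s ∈ S, ∀ x ∈ S', ¬ (openGraph ω).Reachable s x} ∩ E') := by
  have key := hB2 n w S S' (𝓕.indicator 1) (𝓖.indicator 1)
    (bhkMenu_monotone_indicator h𝓕) (bhkMenu_monotone_indicator h𝓖) hSS'
  simp only [bhkMenu_indicator_eq hE, bhkMenu_indicator_eq hE'] at key
  have h := knThm2_setIntegral_indicator w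
    {ω : BondConfig (Fin n) | ∀ s ∈ S, ∀ x ∈ S', ¬ (openGraph ω).Reachable s x} E E'
  have h' := knThm2_setIntegral_indicator w
    {ω : BondConfig (Fin n) | ∀ s ∈ S, ∀ x ∈ S', ¬ (openGraph ω).Reachable s x} E' E'
  rw [h.1, h'.1, h.2] at key
  exact key

/-- Example / test of the menu: BHK Thm 1.3 with the CONJUNCTION `1{o ∈ C(S)}·1{b ∈ C(S)}` against `1{x ∈ C(S)}`:
`μ(N ∩ (S↔o ∩ S↔b))·μ(N ∩ S↔x) ≤ μ(N)·μ(N ∩ ((S↔o ∩ S↔b) ∩ S↔x))`. [cite: VandenbergHaggstromKahn2005, Thm. 1.3 (p. 6)] -/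
theorem bhkMenu_one_conj_example
    (hB1 : ∀ (n : ℕ) (w : Sym2 (Fin n) → unitInterval) (S : Finset (Fin n)) (X : Set (Fin n))
        (F G : Set (Sym2 (Fin n)) → ℝ), Monotone F → Monotone G → (∀ s ∈ S, s ∉ X) →
        (∫ ω in {ω : BondConfig (Fin n) | ∀ s ∈ S, ∀ x ∈ X, ¬ (openGraph ω).Reachable s x},
            F (⋃ s ∈ S, openEdgeCluster ω s) ∂(prodBernoulli w)) *
          (∫ ω in {ω : BondConfig (Fin n) | ∀ s ∈ S, ∀ x ∈ X, ¬ (openGraph ω).Reachable s x},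
            G (⋃ s ∈ S, openEdgeCluster ω s) ∂(prodBernoulli w)) ≤
        (prodBernoulli w).real
            {ω : BondConfig (Fin n) | ∀ s ∈ S, ∀ x ∈ X, ¬ (openGraph ω).Reachable s x} *
          ∫ ω in {ω : BondConfig (Fin n) | ∀ s ∈ S, ∀ x ∈ X, ¬ (openGraph ω).Reachable s x},
            F (⋃ s ∈ S, openEdgeCluster ω s) * G (⋃ s ∈ S, openEdgeCluster ω s)
              ∂(prodBernoulli w))
    (w : Sym2 (Fin n) → unitInterval) (S : Finset (Fin n)) (X : Set (Fin n)) (o b x : Fin n)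
    (hSX : ∀ s ∈ S, s ∉ X) :
    (prodBernoulli w).real
          ({ω : BondConfig (Fin n) | ∀ s ∈ S, ∀ x ∈ X, ¬ (openGraph ω).Reachable s x} ∩
            ((⋃ s ∈ S, openConn s o) ∩ ⋃ s ∈ S, openConn s b)) *
        (prodBernoulli w).real
          ({ω : BondConfig (Fin n) | ∀ s ∈ S, ∀ x ∈ X, ¬ (openGraph ω).Reachable s x} ∩
            ⋃ s ∈ S, openConn s x) ≤
      (prodBernoulli w).real
          {ω : BondConfig (Fin n) | ∀ s ∈ S, ∀ x ∈ X, ¬ (openGraph ω).Reachable s x} *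
        (prodBernoulli w).real
          ({ω : BondConfig (Fin n) | ∀ s ∈ S, ∀ x ∈ X, ¬ (openGraph ω).Reachable s x} ∩
            (((⋃ s ∈ S, openConn s o) ∩ ⋃ s ∈ S, openConn s b) ∩ ⋃ s ∈ S, openConn s x)) := by
  refine bhkMenu_one hB1 w S X
    ({C : Set (Sym2 (Fin n)) | ∃ s ∈ S, (openGraph C).Reachable s o} ∩
      {C : Set (Sym2 (Fin n)) | ∃ s ∈ S, (openGraph C).Reachable s b})
    {C : Set (Sym2 (Fin n)) | ∃ s ∈ S, (openGraph C).Reachable s x}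
    ((bhkMenu_any_isUpperSet S o).inter (bhkMenu_any_isUpperSet S b)) (bhkMenu_any_isUpperSet S x)
    _ _ (fun ω => ?_) (fun ω => bhkMenu_any_mem S x ω) hSX
  rw [Set.mem_inter_iff, Set.mem_inter_iff, bhkMenu_any_mem, bhkMenu_any_mem]

end

section PointLiterals
variable {V : Type*}

/-- The point literal `{C | s ↔ x in C}` (for a source point `s ∈ S`) is an up-set. [folklore] -/
theorem bhkMenu_pt_isUpperSet (s x : V) :
    IsUpperSet {C : Set (Sym2 V) | (openGraph C).Reachable s x} :=
  fun _ _ hCC' h => Set.mem_setOf_eq ▸ (h.mono (openGraph_mono hCC'))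

/-- At `C = C_S(ω)` the point literal `{s ↔ x}` of a source point `s ∈ S` cuts out `{s ↔ x}`. [folklore] -/
theorem bhkMenu_pt_mem (S : Finset V) {s : V} (hs : s ∈ S) (x : V) (ω : BondConfig V) :
    (⋃ s' ∈ S, openEdgeCluster ω s') ∈ {C : Set (Sym2 V) | (openGraph C).Reachable s x} ↔
      ω ∈ (openConn s x : Set (BondConfig V)) :=
  knThm2_reachable_biUnion_iff S hs x ω

/-- The complement-free "negative" use: the indicator of the DOWN-set complement is handled by passing to the
complementary event on the other factor; for convenience, intersections of up-sets are up-sets. [folklore] -/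
theorem bhkMenu_inter_isUpperSet {𝓕 𝓖 : Set (Set (Sym2 V))} (h𝓕 : IsUpperSet 𝓕) (h𝓖 : IsUpperSet 𝓖) :
    IsUpperSet (𝓕 ∩ 𝓖) := h𝓕.inter h𝓖

end PointLiterals

end Summit.CriticalPhenomena.PercolationContinuityZ3.Theorems
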